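import Summits.ResolutionOfSingularities.ResolutionOfSingularities.Theorems.PurelyInseparableDim4ResConeCInfFrameStep
import HarnessLib

/-!
# Purely inseparable four-folds — the C∞ WINDOW: the frame propagates and every step is a pure λ/μ-corner
# (K24b-FRAME, file F2c part 2: cell `res-dim4-pi`, K2(p) lane, slice B)

[OURS · counted 0 · cell `res-dim4-pi` · K2(p) lane holder res-dim4-p-12 g3's split of K24b by file (owners
03:02:06Z/03:23:53Z: F2 = res-dim4-p-2 g4), design ruling (iii) 02:51:49Z («local window, re-framed at the letter
change»).]  Nothing here proves K2(p)/K2(5), `NoIsolatedTrap 5 5` or resolution of singularities in dimension ≥ 4 /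
characteristic `p` — NOT proved.  AI kernel work, weaker than expert review.

* `cInf_frame_entries` — the five frame readings of degree `7` (`u`-flag, two pair-ledger entries, two dead
  `ū²`-row entries) in the three-single form of `cInf_chart_eq_or_eq`, read off the jets (`N ≥ 8`).
* `cInf_frame_window_step` / `cInf_frame_window_next` — one framed stage: the chart is a ledger letter
  (`cInf_chart_eq_or_eq`), the step is a pure corner and the frame is reproduced with parameter `N − 4`
  (`cInf_frame_step` or its `(λ, μ)`-mirror — the frame is symmetric in the two ledger letters).
* **`cInf_frame_window`** — induction: from a framed stage `k` with jet parameter `N`, for every `t` with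
  `4t + 8 ≤ N` the frame holds at `k + t` with parameter `N − 4t` and the step at `k + t` is a pure `λ/μ`-corner
  (`j_{k+t} ∈ {λ, μ}`, `b_{k+t} = 0`, `c_{k+t+1} = CentreBlowup.step 5 univ j_{k+t} 0 c_{k+t}`).  With F2a
  (`…ResConeCInfGameStep`) this feeds res-dim4-p-9 g3's `CInfGame.Window.no_play_after_change` its
  `hfwdL/hfwdM/hevol` on the window (9 steps need `N ≥ 44`); legality and flags are F3 (res-dim4-p-3 g3); the window
  START (straight form, the two jets, the flag at ONE state) is the one-state re-framing (res-dim4-p-1 g4 β1,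
  res-dim4-typ-1 g3 (E-u)/βC3(d)) — by value here, as are the package functions `ℓ, a, λ` of
  `chain_powerCone_package 5` and the weights `|r_k| = 2` (res-dim4-p-2 g4 K28a).
bears_on: LADDER-RESOLUTION:D157-DOOR2 (res-dim4-pi · K2(p) · slice B · K24b-FRAME F2c).  Supports
stmt-ResolutionOfSingularities-16155 (helper).
-/

set_option linter.dupNamespace false -- mandated namespace of this single-conjunct summit

namespace Summit.ResolutionOfSingularities.ResolutionOfSingularities.Theorems.PIDim4

namespace ResCone

open MvPolynomial Finset
open Literature.AlgebraicGeometry.Resolution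
open Literature.AlgebraicGeometry.Resolution.CentreBlowup
open Literature.AlgebraicGeometry.Resolution.Hauser2010
open Literature.AlgebraicGeometry.Resolution.HauserPerlega2019

variable {K : Type} [Field K]

section Chain

variable [CharP K 5] [DecidableEq K]

omit [CharP K 5] in
/-- The frame readings in the three-single form used by `cInf_chart_eq_or_eq`. [OURS · bookkeeping] -/
theorem cInf_frame_entries {F : MvPolynomial (Fin 4) K} {r : Fin 4 →₀ ℕ} {la mu u f : Fin 4} (hlm : la ≠ mu)
    (hlu : la ≠ u) (hlf : la ≠ f) (hmu : mu ≠ u) (hmf : mu ≠ f) (huf : u ≠ f)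
    (hr : r = Finsupp.single la 1 + Finsupp.single mu 1) {N : ℕ} (hN : 8 ≤ N)
    (hled : ∀ d ∈ F.support, d f ≤ 3 → d.degree < N → 2 ≤ d la ∧ 2 ≤ d mu)
    (hrow : ∀ d ∈ F.support, d.degree < N → ¬ (d u = 2 ∧ d f = 0))
    (hV : coeff (r + (Finsupp.single la 1 + Finsupp.single mu 1 + Finsupp.single u 3)) F ≠ 0) :
    coeff (Finsupp.single la 2 + Finsupp.single mu 2 + Finsupp.single u 3) F ≠ 0 ∧
      coeff (Finsupp.single la 1 + Finsupp.single mu 2 + Finsupp.single u 4) F = 0 ∧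
      coeff (Finsupp.single la 2 + Finsupp.single mu 1 + Finsupp.single u 4) F = 0 ∧
      coeff (Finsupp.single la 3 + Finsupp.single mu 2 + Finsupp.single u 2) F = 0 ∧
      coeff (Finsupp.single la 2 + Finsupp.single mu 3 + Finsupp.single u 2) F = 0 := by
  have hz : ∀ x y z : ℕ, (Finsupp.single la x + Finsupp.single mu y + Finsupp.single u z : Fin 4 →₀ ℕ) =
      Finsupp.single la x + Finsupp.single mu y + Finsupp.single u z + Finsupp.single f 0 := by
    intro x y z; rw [Finsupp.single_zero, add_zero]
  have hVe : r + (Finsupp.single la 1 + Finsupp.single mu 1 + Finsupp.single u 3) =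
      Finsupp.single la 2 + Finsupp.single mu 2 + Finsupp.single u 3 := by
    rw [hr, show (Finsupp.single la 2 : Fin 4 →₀ ℕ) = Finsupp.single la 1 + Finsupp.single la 1 by
      rw [← Finsupp.single_add], show (Finsupp.single mu 2 : Fin 4 →₀ ℕ) =
      Finsupp.single mu 1 + Finsupp.single mu 1 by rw [← Finsupp.single_add]]
    abel
  rw [hVe] at hV
  have hL : ∀ x y z : ℕ, x + y + z + 0 < N → (x < 2 ∨ y < 2) →
      coeff (Finsupp.single la x + Finsupp.single mu y + Finsupp.single u z) F = 0 := by
    intro x y z hdeg hxy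
    by_contra h
    have hmem := mem_support_iff.mpr h
    rw [hz] at hmem
    obtain ⟨h1, h2, -, h4⟩ := quad_apply hlm hlu hlf hmu hmf huf x y z 0
    have h' := hled _ hmem (by rw [h4]; omega) (by rw [degree_quad]; exact hdeg)
    rw [h1, h2] at h'
    omega
  have hR : ∀ x y : ℕ, x + y + 2 + 0 < N →
      coeff (Finsupp.single la x + Finsupp.single mu y + Finsupp.single u 2) F = 0 := by
    intro x y hdeg
    by_contra h
    have hmem := mem_support_iff.mpr h
    rw [hz] at hmem
    obtain ⟨-, -, h3, h4⟩ := quad_apply hlm hlu hlf hmu hmf huf x y 2 0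
    exact hrow _ hmem (by rw [degree_quad]; exact hdeg) ⟨h3, h4⟩
  exact ⟨hV, hL 1 2 4 (by omega) (by omega), hL 2 1 4 (by omega) (by omega), hR 3 2 (by omega),
    hR 2 3 (by omega)⟩

/-- One framed stage: the step is a pure `λ/μ`-corner (chart by `cInf_chart_eq_or_eq`, translation by
`cInf_frame_step` or its mirror). [OURS] -/
theorem cInf_frame_window_step {c : ℕ → State K} {j : ℕ → Fin 4} {b : ℕ → Fin 4 → K}
    (hc : ∀ k, IsIsolated 5 (c k).F ∧ Step0 5 (c k) (c (k + 1))) (hw : FreeTail.IsWitnessedChain 5 c j b)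
    (hr0 : ∀ e ∈ (c 0).F.support, (c 0).r ≤ e) (hfloor : ∀ k, ordZero (c k).F ≠ (5 : ℕ)) {k₀ : ℕ}
    (hshade : ∀ k, k₀ ≤ k → (c k).shade = ((4 : ℕ) : ℕ∞))
    (hw2 : ∀ k, k₀ ≤ k → (c k).r.degree = 2)
    {ℓ : ℕ → Fin 4 → K} {a lam : ℕ → K} (hℓ : ∀ k, k₀ ≤ k → ℓ k ≠ 0)
    (hform : ∀ k, k₀ ≤ k → resForm (c k) = C (a k) * (∑ i, C (ℓ k i) * X i) ^ 4)
    (hchart : ∀ k, k₀ ≤ k → ℓ k (j k) + dotProduct (ℓ k) (b k) = 0) (hlam0 : ∀ k, k₀ ≤ k → lam k ≠ 0)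
    (hlam : ∀ k, k₀ ≤ k → ∀ i, i ≠ j k → ℓ (k + 1) i = lam k * ℓ k i)
    {la mu u f : Fin 4} (hlm : la ≠ mu) (hlu : la ≠ u) (hlf : la ≠ f) (hmu : mu ≠ u) (hmf : mu ≠ f)
    (huf : u ≠ f) {k : ℕ} (hk : k₀ ≤ k) {M : ℕ} (hM : 8 ≤ M)
    (hframe : (∀ i, i ≠ f → ℓ k i = 0) ∧ (c k).r = Finsupp.single la 1 + Finsupp.single mu 1 ∧
        (∀ d ∈ (c k).F.support, d f ≤ 3 → d.degree < M → 2 ≤ d la ∧ 2 ≤ d mu) ∧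
        (∀ d ∈ (c k).F.support, d.degree < M → ¬ (d u = 2 ∧ d f = 0)) ∧
        coeff ((c k).r + (Finsupp.single la 1 + Finsupp.single mu 1 + Finsupp.single u 3)) (c k).F ≠ 0) :
    (j k = la ∨ j k = mu) ∧ b k = 0 ∧ c (k + 1) = CentreBlowup.step 5 Finset.univ (j k) 0 (c k) := by
  obtain ⟨hstraight, hr, hled, hrow, hV⟩ := hframe
  obtain ⟨hV', hlA, hlB, hdA, hdB⟩ := cInf_frame_entries hlm hlu hlf hmu hmf huf hr hM hled hrow hV
  have hjk := cInf_chart_eq_or_eq hc hw hr0 hfloor hshade hk (hform (k + 1) (by omega)) (hlam k hk) (hℓ k hk)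
    (hchart k hk) hlm hlu hlf hmu hmf huf hstraight hr (hw2 (k + 1) (by omega)) hV' hlA hlB hdA hdB
  refine ⟨hjk, ?_⟩
  rcases hjk with hj | hj
  · obtain ⟨hb, hs, -⟩ := cInf_frame_step hc hw hr0 hfloor hshade hk (hℓ k hk) (hform k hk) (hchart k hk)
      (hlam0 k hk) (hlam k hk) (hform (k + 1) (by omega)) hlm hlu hlf hmu hmf huf hj hstraight hr
      (hw2 (k + 1) (by omega)) hM hled hrow hV
    rw [hj]; exact ⟨hb, hs⟩
  · have hr' : (c k).r = Finsupp.single mu 1 + Finsupp.single la 1 := by rw [hr, add_comm]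
    have hled' : ∀ d ∈ (c k).F.support, d f ≤ 3 → d.degree < M → 2 ≤ d mu ∧ 2 ≤ d la :=
      fun d hd h1 h2 => (hled d hd h1 h2).symm
    have hV'' : coeff ((c k).r + (Finsupp.single mu 1 + Finsupp.single la 1 + Finsupp.single u 3)) (c k).F ≠ 0 := by
      rw [add_comm (Finsupp.single mu 1) (Finsupp.single la 1)]; exact hV
    obtain ⟨hb, hs, -⟩ := cInf_frame_step hc hw hr0 hfloor hshade hk (hℓ k hk) (hform k hk) (hchart k hk)
      (hlam0 k hk) (hlam k hk) (hform (k + 1) (by omega)) hlm.symm hmu hmf hlu hlf huf hj hstraight hr'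
      (hw2 (k + 1) (by omega)) hM hled' hrow hV''
    rw [hj]; exact ⟨hb, hs⟩

/-- One framed stage: the frame is reproduced at the next stage with jet parameter `M − 4`. [OURS] -/
theorem cInf_frame_window_next {c : ℕ → State K} {j : ℕ → Fin 4} {b : ℕ → Fin 4 → K}
    (hc : ∀ k, IsIsolated 5 (c k).F ∧ Step0 5 (c k) (c (k + 1))) (hw : FreeTail.IsWitnessedChain 5 c j b)
    (hr0 : ∀ e ∈ (c 0).F.support, (c 0).r ≤ e) (hfloor : ∀ k, ordZero (c k).F ≠ (5 : ℕ)) {k₀ : ℕ}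
    (hshade : ∀ k, k₀ ≤ k → (c k).shade = ((4 : ℕ) : ℕ∞))
    (hw2 : ∀ k, k₀ ≤ k → (c k).r.degree = 2)
    {ℓ : ℕ → Fin 4 → K} {a lam : ℕ → K} (hℓ : ∀ k, k₀ ≤ k → ℓ k ≠ 0)
    (hform : ∀ k, k₀ ≤ k → resForm (c k) = C (a k) * (∑ i, C (ℓ k i) * X i) ^ 4)
    (hchart : ∀ k, k₀ ≤ k → ℓ k (j k) + dotProduct (ℓ k) (b k) = 0) (hlam0 : ∀ k, k₀ ≤ k → lam k ≠ 0)
    (hlam : ∀ k, k₀ ≤ k → ∀ i, i ≠ j k → ℓ (k + 1) i = lam k * ℓ k i)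
    {la mu u f : Fin 4} (hlm : la ≠ mu) (hlu : la ≠ u) (hlf : la ≠ f) (hmu : mu ≠ u) (hmf : mu ≠ f)
    (huf : u ≠ f) {k : ℕ} (hk : k₀ ≤ k) {M : ℕ} (hM : 8 ≤ M)
    (hframe : (∀ i, i ≠ f → ℓ k i = 0) ∧ (c k).r = Finsupp.single la 1 + Finsupp.single mu 1 ∧
        (∀ d ∈ (c k).F.support, d f ≤ 3 → d.degree < M → 2 ≤ d la ∧ 2 ≤ d mu) ∧
        (∀ d ∈ (c k).F.support, d.degree < M → ¬ (d u = 2 ∧ d f = 0)) ∧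
        coeff ((c k).r + (Finsupp.single la 1 + Finsupp.single mu 1 + Finsupp.single u 3)) (c k).F ≠ 0) :
    (∀ i, i ≠ f → ℓ (k + 1) i = 0) ∧ (c (k + 1)).r = Finsupp.single la 1 + Finsupp.single mu 1 ∧
      (∀ d ∈ (c (k + 1)).F.support, d f ≤ 3 → d.degree < M - 4 → 2 ≤ d la ∧ 2 ≤ d mu) ∧
      (∀ d ∈ (c (k + 1)).F.support, d.degree < M - 4 → ¬ (d u = 2 ∧ d f = 0)) ∧
      coeff ((c (k + 1)).r + (Finsupp.single la 1 + Finsupp.single mu 1 + Finsupp.single u 3))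
        (c (k + 1)).F ≠ 0 := by
  obtain ⟨hstraight, hr, hled, hrow, hV⟩ := hframe
  obtain ⟨hV', hlA, hlB, hdA, hdB⟩ := cInf_frame_entries hlm hlu hlf hmu hmf huf hr hM hled hrow hV
  have hjk := cInf_chart_eq_or_eq hc hw hr0 hfloor hshade hk (hform (k + 1) (by omega)) (hlam k hk) (hℓ k hk)
    (hchart k hk) hlm hlu hlf hmu hmf huf hstraight hr (hw2 (k + 1) (by omega)) hV' hlA hlB hdA hdB
  rcases hjk with hj | hj
  · obtain ⟨-, -, hr1, hs1, hl1, hw1, hv1⟩ := cInf_frame_step hc hw hr0 hfloor hshade hk (hℓ k hk) (hform k hk)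
      (hchart k hk) (hlam0 k hk) (hlam k hk) (hform (k + 1) (by omega)) hlm hlu hlf hmu hmf huf hj hstraight hr
      (hw2 (k + 1) (by omega)) hM hled hrow hV
    exact ⟨hs1, hr1, hl1, hw1, hv1⟩
  · have hr' : (c k).r = Finsupp.single mu 1 + Finsupp.single la 1 := by rw [hr, add_comm]
    have hled' : ∀ d ∈ (c k).F.support, d f ≤ 3 → d.degree < M → 2 ≤ d mu ∧ 2 ≤ d la :=
      fun d hd h1 h2 => (hled d hd h1 h2).symm
    have hV'' : coeff ((c k).r + (Finsupp.single mu 1 + Finsupp.single la 1 + Finsupp.single u 3)) (c k).F ≠ 0 := by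
      rw [add_comm (Finsupp.single mu 1) (Finsupp.single la 1)]; exact hV
    obtain ⟨-, -, hr1, hs1, hl1, hw1, hv1⟩ := cInf_frame_step hc hw hr0 hfloor hshade hk (hℓ k hk) (hform k hk)
      (hchart k hk) (hlam0 k hk) (hlam k hk) (hform (k + 1) (by omega)) hlm.symm hmu hmf hlu hlf huf hj hstraight
      hr' (hw2 (k + 1) (by omega)) hM hled' hrow hV''
    refine ⟨hs1, by rw [hr1, add_comm], fun d hd h1 h2 => (hl1 d hd h1 h2).symm, hw1, ?_⟩
    rw [add_comm (Finsupp.single la 1) (Finsupp.single mu 1)]; exact hv1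

/-- **THE C∞ WINDOW** (K24b-FRAME F2c): from a framed stage `k` with jet parameter `N` the frame propagates along
the tail for every `t` with `4t + 8 ≤ N` — the vertex form stays straight, the ledger stays `x_λ x_μ`, the
pair-ledger divisibility and the dead `ū²`-row hold below degree `N − 4t`, the `u`-axis flag is alive — and every
step of the window is a PURE `λ/μ`-CORNER: `j_{k+t} ∈ {λ, μ}`, `b_{k+t} = 0`,
`c_{k+t+1} = CentreBlowup.step 5 univ (j_{k+t}) 0 (c_{k+t})`.  (Induction on `t` by `cInf_chart_eq_or_eq` and
`cInf_frame_step` or its `(λ, μ)`-mirror.)  This is the frame side of ruling (iii) «local window, re-framed at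
the letter change»: the window START (straightness, the two jets, the flag at ONE state) is the one-state
re-framing (res-dim4-p-1 g4's β1, res-dim4-typ-1 g3's (E-u) and βC3(d)), taken here by value. [OURS]
[cite: CossartJannsenSaito2020, Thm. 3.10(4), Thm. 9.3] -/
theorem cInf_frame_window {c : ℕ → State K} {j : ℕ → Fin 4} {b : ℕ → Fin 4 → K}
    (hc : ∀ k, IsIsolated 5 (c k).F ∧ Step0 5 (c k) (c (k + 1))) (hw : FreeTail.IsWitnessedChain 5 c j b)
    (hr0 : ∀ e ∈ (c 0).F.support, (c 0).r ≤ e) (hfloor : ∀ k, ordZero (c k).F ≠ (5 : ℕ)) {k₀ : ℕ}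
    (hshade : ∀ k, k₀ ≤ k → (c k).shade = ((4 : ℕ) : ℕ∞))
    (hw2 : ∀ k, k₀ ≤ k → (c k).r.degree = 2)
    {ℓ : ℕ → Fin 4 → K} {a lam : ℕ → K} (hℓ : ∀ k, k₀ ≤ k → ℓ k ≠ 0)
    (hform : ∀ k, k₀ ≤ k → resForm (c k) = C (a k) * (∑ i, C (ℓ k i) * X i) ^ 4)
    (hchart : ∀ k, k₀ ≤ k → ℓ k (j k) + dotProduct (ℓ k) (b k) = 0) (hlam0 : ∀ k, k₀ ≤ k → lam k ≠ 0)
    (hlam : ∀ k, k₀ ≤ k → ∀ i, i ≠ j k → ℓ (k + 1) i = lam k * ℓ k i)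
    {la mu u f : Fin 4} (hlm : la ≠ mu) (hlu : la ≠ u) (hlf : la ≠ f) (hmu : mu ≠ u) (hmf : mu ≠ f)
    (huf : u ≠ f) {k : ℕ} (hk : k₀ ≤ k) (hstraight : ∀ i, i ≠ f → ℓ k i = 0)
    (hr : (c k).r = Finsupp.single la 1 + Finsupp.single mu 1) {N : ℕ}
    (hled : ∀ d ∈ (c k).F.support, d f ≤ 3 → d.degree < N → 2 ≤ d la ∧ 2 ≤ d mu)
    (hrow : ∀ d ∈ (c k).F.support, d.degree < N → ¬ (d u = 2 ∧ d f = 0))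
    (hV : coeff ((c k).r + (Finsupp.single la 1 + Finsupp.single mu 1 + Finsupp.single u 3)) (c k).F ≠ 0) :
    ∀ t : ℕ, 4 * t + 8 ≤ N →
      ((∀ i, i ≠ f → ℓ (k + t) i = 0) ∧ (c (k + t)).r = Finsupp.single la 1 + Finsupp.single mu 1 ∧
        (∀ d ∈ (c (k + t)).F.support, d f ≤ 3 → d.degree < N - 4 * t → 2 ≤ d la ∧ 2 ≤ d mu) ∧
        (∀ d ∈ (c (k + t)).F.support, d.degree < N - 4 * t → ¬ (d u = 2 ∧ d f = 0)) ∧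
        coeff ((c (k + t)).r + (Finsupp.single la 1 + Finsupp.single mu 1 + Finsupp.single u 3))
          (c (k + t)).F ≠ 0) ∧
      (j (k + t) = la ∨ j (k + t) = mu) ∧ b (k + t) = 0 ∧
        c (k + t + 1) = CentreBlowup.step 5 Finset.univ (j (k + t)) 0 (c (k + t)) := by
  intro t
  induction t with
  | zero =>
    intro hN
    have hframe : (∀ i, i ≠ f → ℓ (k + 0) i = 0) ∧ (c (k + 0)).r = Finsupp.single la 1 + Finsupp.single mu 1 ∧
        (∀ d ∈ (c (k + 0)).F.support, d f ≤ 3 → d.degree < N - 4 * 0 → 2 ≤ d la ∧ 2 ≤ d mu) ∧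
        (∀ d ∈ (c (k + 0)).F.support, d.degree < N - 4 * 0 → ¬ (d u = 2 ∧ d f = 0)) ∧
        coeff ((c (k + 0)).r + (Finsupp.single la 1 + Finsupp.single mu 1 + Finsupp.single u 3))
          (c (k + 0)).F ≠ 0 := by
      rw [Nat.add_zero, Nat.mul_zero, Nat.sub_zero]
      exact ⟨hstraight, hr, hled, hrow, hV⟩
    exact ⟨hframe, cInf_frame_window_step hc hw hr0 hfloor hshade hw2 hℓ hform hchart hlam0 hlam hlm hlu hlf hmu
      hmf huf (k := k + 0) (by omega) (by omega) hframe⟩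
  | succ t ih =>
    intro hN
    obtain ⟨hframe, -, -, -⟩ := ih (by omega)
    have hnext := cInf_frame_window_next hc hw hr0 hfloor hshade hw2 hℓ hform hchart hlam0 hlam hlm hlu hlf hmu
      hmf huf (k := k + t) (by omega) (by omega) hframe
    have heq : k + (t + 1) = k + t + 1 := by omega
    have heq' : N - 4 * (t + 1) = N - 4 * t - 4 := by omega
    rw [heq, heq']
    exact ⟨hnext, cInf_frame_window_step hc hw hr0 hfloor hshade hw2 hℓ hform hchart hlam0 hlam hlm hlu hlf hmu
      hmf huf (k := k + t + 1) (by omega) (by omega) hnext⟩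

end Chain

end ResCone

end Summit.ResolutionOfSingularities.ResolutionOfSingularities.Theorems.PIDim4
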